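import Mathlib.Analysis.Calculus.Gradient.Basic
import Mathlib.Analysis.InnerProductSpace.Calculus
import Mathlib.Geometry.Manifold.PartitionOfUnity
import Mathlib.Analysis.Calculus.ContDiff.Basic
import HarnessLib

/-!
# The normalised gradient field of a regular hypersurface `{F = 0}` of Euclidean space, cut off
# to compact support

Topic `Literature/Topology/FourManifolds` (infrastructure for the fact seat
`provefact-Literature.Geometry.Riemannian.LawsonMichelsohn1984_surrounding`: the strong isotopy of
Lawson–Michelsohn's Thm. 6.1 is realised by flowing the hypersurface `e(N) = {F = 0}` along the
normalised gradient of its defining function `F`; this file constructs that vector field on all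
of `E` with compact support, so that the tree's `CompactSupportFlow.lean` integrates it).
Everything here is **proved**.

For a finite-dimensional real inner product space `E`, a `C^∞` function `F : E → ℝ` and a compact
set `Z` on which `dF ≠ 0` (think `Z = {F = 0}`):

* `exists_contDiff_plateau_cthickening` — smooth plateau functions `E → [0, 1]` equal to `1` on a
  closed `δ`-neighbourhood of a compact set, with compact support inside a prescribed open set;
* `exists_gradientCollarField` — there are `ρ > 0`, `L ≥ 0` and a `C^∞` compactly supported
  vector field `V : E → E` with `dF(V) ∈ [0, 1]` everywhere, **`dF(V) = 1` on the closed
  `ρ`-neighbourhood of `Z`**, `‖V‖ ≤ L`, `V = 0` off the closed `2ρ`-neighbourhood of `Z`, on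
  which `dF ≠ 0` (the field is `λ • (‖∇F‖² + 1 - λ')⁻¹ • ∇F` for two plateau functions
  `λ`, `λ'`).

## References

* J. Milnor, *Morse theory* (1963), proof of Thm. 3.1 (the field `X/⟨X, grad f⟩` normalised to
  `⟨Y, grad f⟩ = 1` on a compact set, vanishing off a compact neighbourhood). [Milnor1963]
* J. M. Lee, *Introduction to Smooth Manifolds*, 2nd ed. (2013), Prop. 2.25 (smooth bump
  functions for closed sets). [LeeSmoothManifolds2013]
-/

noncomputable section

open Set Function Metric
open scoped Topology ContDiff InnerProductSpace Manifold

namespace Literature.Topology.FourManifolds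

variable {E : Type*} [NormedAddCommGroup E] [InnerProductSpace ℝ E] [FiniteDimensional ℝ E]

/-- **Smooth plateau functions for a compact set in a finite-dimensional space**: for a compact
`K` inside an open `U` there are `δ > 0` with `cthickening (2δ) K ⊆ U` and a `C^∞` function
`E → [0, 1]` equal to `1` on `cthickening δ K`, with compact support contained in
`cthickening (2δ) K`. [cite: LeeSmoothManifolds2013, Prop. 2.25] -/
theorem exists_contDiff_plateau_cthickening {K U : Set E} (hK : IsCompact K) (hU : IsOpen U)
    (hKU : K ⊆ U) :
    ∃ (δ : ℝ) (g : E → ℝ), 0 < δ ∧ cthickening (2 * δ) K ⊆ U ∧ ContDiff ℝ ∞ g ∧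
      (∀ x, g x ∈ Icc (0 : ℝ) 1) ∧ (∀ x ∈ cthickening δ K, g x = 1) ∧
      HasCompactSupport g ∧ tsupport g ⊆ cthickening (2 * δ) K := by
  obtain ⟨δ₀, hδ₀, hsub⟩ := hK.exists_cthickening_subset_open hU hKU
  set δ : ℝ := δ₀ / 2 with hδ
  have hδpos : 0 < δ := by positivity
  have h2δ : 2 * δ = δ₀ := by rw [hδ]; ring
  have hs : IsClosed (thickening (2 * δ) K)ᶜ := isOpen_thickening.isClosed_compl
  have ht : IsClosed (cthickening δ K) := isClosed_cthickening
  have hd : Disjoint (thickening (2 * δ) K)ᶜ (cthickening δ K) := by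
    refine disjoint_compl_left_iff_subset.2 ?_
    exact cthickening_subset_thickening' (by linarith) (by linarith) K
  obtain ⟨g, hgs, hgt, hg01⟩ :=
    exists_contMDiffMap_zero_one_of_isClosed (I := 𝓘(ℝ, E)) (n := ⊤) hs ht hd
  have hgc : ContDiff ℝ ∞ g := contMDiff_iff_contDiff.1 g.contMDiff
  have hsupp : tsupport g ⊆ cthickening (2 * δ) K := by
    refine closure_minimal (fun x hx => ?_) isClosed_cthickening
    by_contra hx'
    have hx2 : x ∈ (thickening (2 * δ) K)ᶜ := fun h => hx' (thickening_subset_cthickening _ _ h)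
    exact hx (hgs hx2)
  refine ⟨δ, g, hδpos, h2δ ▸ hsub, hgc, fun x => hg01 x, fun x hx => hgt hx, ?_, hsupp⟩
  exact IsCompact.of_isClosed_subset hK.cthickening (isClosed_tsupport _) hsupp

/-- **The cut-off normalised gradient field.**  For a `C^∞` function `F` on a
finite-dimensional inner product space and a compact `Z` on which `dF ≠ 0`, there are `ρ > 0`,
`L ≥ 0` and a `C^∞` compactly supported vector field `V` with `0 ≤ dF(V) ≤ 1` everywhere,
`dF(V) = 1` on `cthickening ρ Z`, `‖V‖ ≤ L` everywhere, `V = 0` off `cthickening (2 * ρ) Z`, and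
`dF ≠ 0` on `cthickening (2 * ρ) Z` (Milnor's normalised gradient `Y = X/⟨X, grad f⟩`, cut off).
[cite: Milnor1963, proof of Thm. 3.1] -/
theorem exists_gradientCollarField {F : E → ℝ} (hF : ContDiff ℝ ∞ F) {Z : Set E} (hZ : IsCompact Z)
    (hreg : ∀ x ∈ Z, fderiv ℝ F x ≠ 0) :
    ∃ (ρ L : ℝ) (V : E → E), 0 < ρ ∧ 0 ≤ L ∧ ContDiff ℝ ∞ V ∧ HasCompactSupport V ∧
      (∀ x, fderiv ℝ F x (V x) ∈ Icc (0 : ℝ) 1) ∧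
      (∀ x ∈ cthickening ρ Z, fderiv ℝ F x (V x) = 1) ∧
      (∀ x, ‖V x‖ ≤ L) ∧ (∀ x ∉ cthickening (2 * ρ) Z, V x = 0) ∧
      (∀ x ∈ cthickening (2 * ρ) Z, fderiv ℝ F x ≠ 0) := by
  -- the open set where `dF ≠ 0`
  set U : Set E := {x | fderiv ℝ F x ≠ 0} with hU
  have hfd : ContDiff ℝ ∞ (fderiv ℝ F) := hF.fderiv_right (m := ∞) (by simp)
  have hUo : IsOpen U := isOpen_ne_fun hfd.continuous continuous_const
  have hZU : Z ⊆ U := fun x hx => hreg x hx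
  -- the outer plateau `λ'`
  obtain ⟨δ', lam', hδ', hsub', hlam'c, hlam'01, hlam'1, -, hlam'supp⟩ :=
    exists_contDiff_plateau_cthickening hZ hUo hZU
  -- the inner plateau `λ`, supported where `λ' = 1`
  have hZin : Z ⊆ thickening δ' Z := self_subset_thickening hδ' Z
  obtain ⟨ρ, lam, hρ, hsub, hlamc, hlam01, hlam1, hlamcs, hlamsupp⟩ :=
    exists_contDiff_plateau_cthickening hZ isOpen_thickening hZin
  -- inclusions
  have h2ρU : cthickening (2 * ρ) Z ⊆ U := fun x hx =>
    hsub' (cthickening_mono (by linarith) Z (thickening_subset_cthickening _ _ (hsub hx)))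
  have h2ρlam' : ∀ x ∈ cthickening (2 * ρ) Z, lam' x = 1 := fun x hx =>
    hlam'1 x (thickening_subset_cthickening _ _ (hsub hx))
  -- the gradient
  set g : E → E := fun x => (InnerProductSpace.toDual ℝ E).symm (fderiv ℝ F x) with hg
  have hgc : ContDiff ℝ ∞ g :=
    (InnerProductSpace.toDual ℝ E).symm.toContinuousLinearEquiv.contDiff.comp hfd
  have hg_inner : ∀ x, fderiv ℝ F x (g x) = ‖g x‖ ^ 2 := fun x => by
    rw [← real_inner_self_eq_norm_sq, hg, InnerProductSpace.toDual_symm_apply]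
  have hg_ne : ∀ x ∈ U, g x ≠ 0 := fun x hx h => by
    apply hx
    have : fderiv ℝ F x = InnerProductSpace.toDual ℝ E (g x) := by
      rw [hg, LinearIsometryEquiv.apply_symm_apply]
    rw [this, h, map_zero]
  -- the denominator `‖g‖² + 1 - λ'`, positive everywhere
  set den : E → ℝ := fun x => ‖g x‖ ^ 2 + 1 - lam' x with hden
  have hden_pos : ∀ x, 0 < den x := by
    intro x
    have h1 : lam' x ≤ 1 := (hlam'01 x).2
    rcases h1.lt_or_eq with hlt | heq
    · show 0 < ‖g x‖ ^ 2 + 1 - lam' x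
      nlinarith [sq_nonneg ‖g x‖]
    · -- `λ' x = 1`: `x ∈ tsupport λ' ⊆ U`, so `g x ≠ 0`
      have hx : x ∈ tsupport lam' := subset_tsupport _ (by
        show lam' x ≠ 0
        rw [heq]; exact one_ne_zero)
      have hgx : g x ≠ 0 := hg_ne x (hsub' (hlam'supp hx))
      have : 0 < ‖g x‖ ^ 2 := by positivity
      show 0 < ‖g x‖ ^ 2 + 1 - lam' x
      linarith
  have hdenc : ContDiff ℝ ∞ den :=
    ((hgc.norm_sq ℝ).add contDiff_const).sub hlam'c
  have hinvc : ContDiff ℝ ∞ fun x => (den x)⁻¹ := hdenc.inv fun x => (hden_pos x).ne'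
  -- the field
  set V : E → E := fun x => lam x • ((den x)⁻¹ • g x) with hV
  have hVc : ContDiff ℝ ∞ V := hlamc.smul (hinvc.smul hgc)
  have hVcs : HasCompactSupport V := hlamcs.smul_right
  have hdFV : ∀ x, fderiv ℝ F x (V x) = lam x * ((den x)⁻¹ * ‖g x‖ ^ 2) := fun x => by
    show fderiv ℝ F x (lam x • ((den x)⁻¹ • g x)) = _
    rw [map_smul, map_smul, hg_inner, smul_eq_mul, smul_eq_mul]
  -- bound on `‖V‖`
  obtain ⟨C, hC⟩ := hVc.continuous.bounded_above_of_compact_support hVcs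
  refine ⟨ρ, max C 0, V, hρ, le_max_right _ _, hVc, hVcs, fun x => ?_, fun x hx => ?_,
    fun x => (hC x).trans (le_max_left _ _), fun x hx => ?_, fun x hx => h2ρU hx⟩
  · -- `dF(V) ∈ [0, 1]`
    rw [hdFV]
    have h0 : 0 ≤ (den x)⁻¹ * ‖g x‖ ^ 2 := by
      have := (hden_pos x).le
      positivity
    have h1 : (den x)⁻¹ * ‖g x‖ ^ 2 ≤ 1 := by
      rw [inv_mul_le_iff₀ (hden_pos x), mul_one]
      show ‖g x‖ ^ 2 ≤ ‖g x‖ ^ 2 + 1 - lam' x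
      linarith [(hlam'01 x).2]
    exact ⟨mul_nonneg (hlam01 x).1 h0,
      (mul_le_mul (hlam01 x).2 h1 h0 zero_le_one).trans (by rw [one_mul])⟩
  · -- `dF(V) = 1` on `cthickening ρ Z`
    rw [hdFV, hlam1 x hx, one_mul]
    have hx2 : x ∈ cthickening (2 * ρ) Z := cthickening_mono (by linarith) Z hx
    have hl' : lam' x = 1 := h2ρlam' x hx2
    have hgx : g x ≠ 0 := hg_ne x (h2ρU hx2)
    have hpos : 0 < ‖g x‖ ^ 2 := by positivity
    have : den x = ‖g x‖ ^ 2 := by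
      show ‖g x‖ ^ 2 + 1 - lam' x = ‖g x‖ ^ 2
      rw [hl']; ring
    rw [this, inv_mul_cancel₀ hpos.ne']
  · -- `V = 0` off `cthickening (2ρ) Z ⊇ tsupport λ`
    have hlam0 : lam x = 0 := by
      by_contra h
      exact hx (hlamsupp (subset_tsupport _ h))
    show lam x • ((den x)⁻¹ • g x) = 0
    rw [hlam0, zero_smul]

end Literature.Topology.FourManifolds

end
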